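import Literature.AlgebraicGeometry.Resolution.BertiniRegularLocus
import Mathlib.LinearAlgebra.Dual.Lemmas
import HarnessLib

/-!
# Bertini on the regular locus, iterated; generic avoidance of primes and of subspaces

Topic: `Literature/AlgebraicGeometry/Resolution`. Algebraic complements to `BertiniAffine` /
`BertiniRegularLocus` used to choose several general hyperplane sections one after the other
(Hartshorne II 8.18 applied repeatedly; de Jong 1996, 2.11 and the Bertini paragraph of 4.11):

* `isGeneric_apply_ne_zero`, `isGeneric_apply_notMem` — a non-zero (resp. surjective) `k`-linear
  map `kᶥ → V` is generically non-zero (resp. generically avoids a proper subspace);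
* `isGeneric_linComb_notMem_ideal` — **a generic hyperplane avoids a given point, closed or
  not**: `Σ tⱼ uⱼ ∉ I` generically as soon as some `uⱼ ∉ I` (no maximality of `I` needed);
* `isGeneric_isRegularLocalRing_quotient_sup` — **Bertini on the regular locus of a closed
  subscheme `V(I) ⊆ Spec A`**, stated on `A`: for generic `t`, at every closed point `𝔪 ⊇ I` at
  which `A_𝔪/I A_𝔪` is regular and `s_t ∈ 𝔪`, the ring `A_𝔪/(I + s_t) A_𝔪` is regular
  (`BertiniRegularLocus` for `A/I`, transported along `(A/I)_{𝔪/I} ≅ A_𝔪/I A_𝔪`).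

Everything is proved; no named facts.

## References

* R. Hartshorne, *Algebraic Geometry* (1977), II Thm. 8.18 and Rem. 8.18.1. [Hartshorne1977]
* A. J. de Jong, *Smoothness, semi-stability and alterations*, Publ. Math. IHÉS 83 (1996), 2.11,
  proof of 4.11 (p. 68). [DeJong1996]
-/

noncomputable section

open IsLocalRing

universe u v

namespace Literature.AlgebraicGeometry.Resolution

namespace BertiniAffine

variable {k : Type u} [Field k] {ι : Type v} [Fintype ι]

/-! ### Generic non-vanishing of linear maps -/

/-- **A non-zero linear map is generically non-zero.** [folklore] -/
theorem isGeneric_apply_ne_zero [DecidableEq ι] {V : Type*} [AddCommGroup V] [Module k V]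
    (L : (ι → k) →ₗ[k] V) (hL : L ≠ 0) : IsGeneric fun t : ι → k => L t ≠ 0 := by
  obtain ⟨t₀, ht₀⟩ : ∃ t₀, L t₀ ≠ 0 := by
    by_contra h
    exact hL (LinearMap.ext fun t => not_not.mp (not_exists.mp h t))
  obtain ⟨ψ, hψ⟩ : ∃ ψ : Module.Dual k V, ψ (L t₀) ≠ 0 := by
    by_contra h
    exact ht₀ ((Module.forall_dual_apply_eq_zero_iff k (L t₀)).mp fun ψ =>
      not_not.mp (not_exists.mp h ψ))
  have hφ : ψ ∘ₗ L ≠ 0 := fun h0 => hψ (by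
    have := LinearMap.congr_fun h0 t₀
    simpa using this)
  exact (isGeneric_ne_zero_of_linearMap (ψ ∘ₗ L) hφ).mono fun t ht h0 => ht (by
    simp [h0])

/-- **A surjective linear map generically avoids a proper subspace.** [folklore] -/
theorem isGeneric_apply_notMem [DecidableEq ι] {V : Type*} [AddCommGroup V] [Module k V]
    (L : (ι → k) →ₗ[k] V) (hL : Function.Surjective L) (W : Submodule k V) (hW : W ≠ ⊤) :
    IsGeneric fun t : ι → k => L t ∉ W := by
  obtain ⟨ψ, hψ, hWψ⟩ := W.exists_le_ker_of_lt_top hW.lt_top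
  have hφ : ψ ∘ₗ L ≠ 0 := by
    intro h0
    apply hψ
    refine LinearMap.ext fun v => ?_
    obtain ⟨t, rfl⟩ := hL v
    exact LinearMap.congr_fun h0 t
  refine (isGeneric_ne_zero_of_linearMap (ψ ∘ₗ L) hφ).mono fun t ht hmem => ht ?_
  exact LinearMap.mem_ker.1 (hWψ hmem)

variable {A : Type u} [CommRing A] [Algebra k A]

/-- The linear combination `t ↦ Σ tⱼ uⱼ` as a `k`-linear map. [folklore] -/
def linCombₗ (u : ι → A) : (ι → k) →ₗ[k] A := Fintype.linearCombination k u

/-- `linCombₗ u t = linComb u t`. [folklore] -/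
@[simp]
theorem linCombₗ_apply (u : ι → A) (t : ι → k) : linCombₗ (k := k) u t = linComb u t := by
  simp [linCombₗ, linComb, Fintype.linearCombination_apply]

/-- **A generic hyperplane avoids a given (prime) ideal**: if some `uⱼ ∉ I` then `Σ tⱼ uⱼ ∉ I`
for generic `t`. (For `I` the prime of a non-closed point this is "the generic hyperplane does not
contain a given irreducible subvariety".) [folklore] -/
theorem isGeneric_linComb_notMem_ideal [DecidableEq ι] (u : ι → A) (I : Ideal A)
    (h : ∃ j, u j ∉ I) : IsGeneric fun t : ι → k => linComb u t ∉ I := by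
  let L : (ι → k) →ₗ[k] A ⧸ I := (Ideal.Quotient.mkₐ k I).toLinearMap ∘ₗ linCombₗ u
  have hL : ∀ t, L t = Ideal.Quotient.mk I (linComb u t) := fun t => by simp [L]
  have hL0 : L ≠ 0 := by
    obtain ⟨j, hj⟩ := h
    intro h0
    have := LinearMap.congr_fun h0 (Pi.single j 1)
    rw [hL, LinearMap.zero_apply, Ideal.Quotient.eq_zero_iff_mem] at this
    apply hj
    simpa [linComb, Finset.sum_pi_single', Pi.single_apply] using this
  refine (isGeneric_apply_ne_zero L hL0).mono fun t ht hmem => ht ?_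
  rw [hL, Ideal.Quotient.eq_zero_iff_mem]
  exact hmem

/-! ### Localisation at `𝔪 ⊇ I` commutes with passing to `A/I` -/

section QuotLoc

variable (I : Ideal A) (𝔪 : Ideal A) [𝔪.IsMaximal] (𝔫 : Ideal (A ⧸ I)) [𝔫.IsPrime]
  (h𝔫 : 𝔫 = 𝔪.map (Ideal.Quotient.mk I))

/-- `𝔪/I` is maximal for `I ≤ 𝔪`. [folklore] -/
theorem map_mk_isMaximal (hI : I ≤ 𝔪) : (𝔪.map (Ideal.Quotient.mk I)).IsMaximal := by
  refine (Ideal.map_eq_top_or_isMaximal_of_surjective _ Ideal.Quotient.mk_surjective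
    (I := 𝔪) inferInstance).resolve_left fun htop => ?_
  have : (1 : A) ∈ 𝔪 := by
    have h1 : Ideal.Quotient.mk I 1 ∈ 𝔪.map (Ideal.Quotient.mk I) := by
      rw [htop]; exact Submodule.mem_top
    exact (Ideal.mem_quotient_iff_mem hI).mp h1
  exact (inferInstance : 𝔪.IsMaximal).ne_top (Ideal.eq_top_of_isUnit_mem _ this isUnit_one)

include h𝔫 in
/-- `I ≤ 𝔪` as soon as `𝔪/I` is a proper ideal. [folklore] -/
theorem le_of_map_mk_ne_top : I ≤ 𝔪 := by
  intro a ha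
  by_contra h
  have hsup : 𝔪 ⊔ Ideal.span {a} = ⊤ := (inferInstance : 𝔪.IsMaximal).1.2 _
    (lt_of_le_of_ne le_sup_left fun heq => h (heq ▸ Ideal.mem_sup_right (Ideal.subset_span rfl)))
  apply (inferInstance : 𝔫.IsPrime).ne_top
  rw [h𝔫, Ideal.eq_top_iff_one]
  have h1 : (1 : A) ∈ 𝔪 ⊔ Ideal.span {a} := hsup ▸ Submodule.mem_top
  obtain ⟨m, hm, b, hb, hmb⟩ := Submodule.mem_sup.mp h1
  obtain ⟨c, rfl⟩ := Ideal.mem_span_singleton'.mp hb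
  have : Ideal.Quotient.mk I 1 = Ideal.Quotient.mk I m := by
    rw [← hmb, map_add, map_mul, Ideal.Quotient.eq_zero_iff_mem.mpr ha, mul_zero, add_zero]
  rw [← map_one (Ideal.Quotient.mk I), this]
  exact Ideal.mem_map_of_mem _ hm

include h𝔫 in
/-- The submonoid at which `A_𝔪/I A_𝔪` is a localisation of `A/I` (Mathlib) is the complement of
`𝔪/I`. [folklore] -/
theorem algebraMapSubmonoid_primeCompl_eq :
    Algebra.algebraMapSubmonoid (A ⧸ I) 𝔪.primeCompl = 𝔫.primeCompl := by
  have hI : I ≤ 𝔪 := le_of_map_mk_ne_top I 𝔪 𝔫 h𝔫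
  ext x
  obtain ⟨a, rfl⟩ := Ideal.Quotient.mk_surjective x
  simp only [Algebra.algebraMapSubmonoid, Submonoid.mem_map, Ideal.Quotient.algebraMap_eq]
  constructor
  · rintro ⟨b, hb, hba⟩
    intro hmem
    rw [← hba, h𝔫] at hmem
    exact hb ((Ideal.mem_quotient_iff_mem hI).mp hmem)
  · intro ha
    exact ⟨a, fun h => ha (h𝔫 ▸ (Ideal.mem_quotient_iff_mem hI).mpr h), rfl⟩

/-- **`(A/I)_{𝔪/I} ≅ A_𝔪 / I A_𝔪`** as `A/I`-algebras (`𝔫 = 𝔪/I`). [folklore] -/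
def quotLocEquiv :
    Localization.AtPrime 𝔫 ≃ₐ[A ⧸ I]
      Localization.AtPrime 𝔪 ⧸ I.map (algebraMap A (Localization.AtPrime 𝔪)) :=
  haveI : IsLocalization 𝔫.primeCompl
      (Localization.AtPrime 𝔪 ⧸ I.map (algebraMap A (Localization.AtPrime 𝔪))) := by
    rw [← algebraMapSubmonoid_primeCompl_eq I 𝔪 𝔫 h𝔫]
    infer_instance
  IsLocalization.algEquiv 𝔫.primeCompl _ _

/-- `quotLocEquiv` on `ā/1` is the class of `a/1`. [folklore] -/
theorem quotLocEquiv_algebraMap (a : A) :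
    quotLocEquiv I 𝔪 𝔫 h𝔫 (algebraMap (A ⧸ I) _ (Ideal.Quotient.mk I a)) =
      Ideal.Quotient.mk _ (algebraMap A (Localization.AtPrime 𝔪) a) := by
  rw [AlgEquiv.commutes]
  rfl

include h𝔫 in
/-- **Regularity transfers along `(A/I)_{𝔪/I} / (s̄) ≅ A_𝔪 / (I + (s)) A_𝔪`.** [folklore] -/
theorem isRegularLocalRing_quotient_map_sup (s : A)
    (H : IsRegularLocalRing (Localization.AtPrime 𝔫 ⧸
      Ideal.span {algebraMap (A ⧸ I) (Localization.AtPrime 𝔫) (Ideal.Quotient.mk I s)})) :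
    IsRegularLocalRing (Localization.AtPrime 𝔪 ⧸
      (I ⊔ Ideal.span {s}).map (algebraMap A (Localization.AtPrime 𝔪))) := by
  set Am := Localization.AtPrime 𝔪
  set IA : Ideal Am := I.map (algebraMap A Am)
  set sA : Am := algebraMap A Am s
  have hJ : Ideal.span {Ideal.Quotient.mk IA sA} =
      (Ideal.span {algebraMap (A ⧸ I) (Localization.AtPrime 𝔫) (Ideal.Quotient.mk I s)}).map
        ((quotLocEquiv I 𝔪 𝔫 h𝔫).toRingEquiv : Localization.AtPrime 𝔫 →+* Am ⧸ IA) := by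
    rw [Ideal.map_span, Set.image_singleton]
    congr 2
    exact (quotLocEquiv_algebraMap I 𝔪 𝔫 h𝔫 s).symm
  have e1 := Ideal.quotientEquiv _ _ (quotLocEquiv I 𝔪 𝔫 h𝔫).toRingEquiv hJ
  have h1 : IsRegularLocalRing ((Am ⧸ IA) ⧸ Ideal.span {Ideal.Quotient.mk IA sA}) :=
    @IsRegularLocalRing.of_ringEquiv _ _ H _ _ e1
  have h : Ideal.span {Ideal.Quotient.mk IA sA} = (Ideal.span {sA}).map (Ideal.Quotient.mk IA) := by
    rw [Ideal.map_span, Set.image_singleton]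
  have e2 := (Ideal.quotEquivOfEq h).trans (DoubleQuot.quotQuotEquivQuotSup IA (Ideal.span {sA}))
  have h2 : IsRegularLocalRing (Am ⧸ (IA ⊔ Ideal.span {sA})) :=
    @IsRegularLocalRing.of_ringEquiv _ _ h1 _ _ e2
  have h' : IA ⊔ Ideal.span {sA} = (I ⊔ Ideal.span {s}).map (algebraMap A Am) := by
    rw [Ideal.map_sup, Ideal.map_span, Set.image_singleton]
  exact @IsRegularLocalRing.of_ringEquiv _ _ h2 _ _ (Ideal.quotEquivOfEq h')

end QuotLoc

/-! ### Bertini on the regular locus of `V(I)` -/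

/-- The tangent-separation hypothesis descends to quotients. [folklore] -/
theorem surjective_linCombQuotSq_quotient (u : ι → A) (I : Ideal A) (𝔪 : Ideal A)
    (hu : Function.Surjective (linCombQuotSq (k := k) u 𝔪)) :
    Function.Surjective
      (linCombQuotSq (k := k) (Ideal.Quotient.mk I ∘ u) (𝔪.map (Ideal.Quotient.mk I))) := by
  -- the surjection `A/𝔪² → (A/I)/(𝔪/I)²`
  have hle : 𝔪 ^ 2 ≤ ((𝔪.map (Ideal.Quotient.mk I)) ^ 2).comap (Ideal.Quotient.mk I) := by
    rw [← Ideal.map_le_iff_le_comap, Ideal.map_pow]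
  let θ := Ideal.quotientMap ((𝔪.map (Ideal.Quotient.mk I)) ^ 2) (Ideal.Quotient.mk I) hle
  have hθ : Function.Surjective θ :=
    Ideal.quotientMap_surjective Ideal.Quotient.mk_surjective
  have hcomp : ∀ t, linCombQuotSq (k := k) (Ideal.Quotient.mk I ∘ u) (𝔪.map (Ideal.Quotient.mk I)) t =
      θ (linCombQuotSq (k := k) u 𝔪 t) := by
    intro t
    rw [linCombQuotSq_apply, linCombQuotSq_apply]
    have : linComb (Ideal.Quotient.mk I ∘ u) t = Ideal.Quotient.mk I (linComb u t) := by
      simp only [linComb, map_sum, Function.comp_apply]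
      refine Finset.sum_congr rfl fun j _ => ?_
      rw [Algebra.smul_def, Algebra.smul_def, map_mul]
      rfl
    rw [this]
    rfl
  intro y
  obtain ⟨x, rfl⟩ := hθ y
  obtain ⟨t, rfl⟩ := hu x
  exact ⟨t, hcomp t⟩

set_option maxHeartbeats 400000 in
/-- **Bertini on the regular locus of a closed subscheme `V(I) ⊆ Spec A`, read on `A`.** For `A`
of finite type over an algebraically closed field, `u : ι → A` separating tangent vectors at the
closed points, and an ideal `I`: for generic `t`, at every maximal `𝔪 ⊇ I` with `A_𝔪/I A_𝔪`
regular and `s_t = Σ tⱼ uⱼ ∈ 𝔪`, the local ring `A_𝔪/(I + (s_t)) A_𝔪` is regular. (Apply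
`BertiniRegularLocus` to `A/I` and transport along `(A/I)_{𝔪/I} ≅ A_𝔪/IA_𝔪`.) Iterating, `j`
general hyperplane sections of a regular locus stay regular. [cite: Hartshorne1977, II Thm. 8.18 and Rem. 8.18.1] -/
theorem isGeneric_isRegularLocalRing_quotient_sup [IsAlgClosed k] [Algebra.FiniteType k A]
    (u : ι → A)
    (hu : ∀ 𝔪 : Ideal A, 𝔪.IsMaximal → Function.Surjective (linCombQuotSq (k := k) u 𝔪))
    (I : Ideal A) :
    IsGeneric fun t : ι → k => ∀ (𝔪 : Ideal A) [𝔪.IsMaximal], I ≤ 𝔪 →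
      IsRegularLocalRing (Localization.AtPrime 𝔪 ⧸ I.map (algebraMap A (Localization.AtPrime 𝔪))) →
        linComb u t ∈ 𝔪 →
          IsRegularLocalRing (Localization.AtPrime 𝔪 ⧸
            (I ⊔ Ideal.span {linComb u t}).map (algebraMap A (Localization.AtPrime 𝔪))) := by
  classical
  -- Bertini on the regular locus of `B = A/I`
  haveI : Algebra.FiniteType k (A ⧸ I) :=
    Algebra.FiniteType.of_surjective (Ideal.Quotient.mkₐ k I) Ideal.Quotient.mk_surjective
  have huB : ∀ 𝔫 : Ideal (A ⧸ I), 𝔫.IsMaximal →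
      Function.Surjective (linCombQuotSq (k := k) (Ideal.Quotient.mk I ∘ u) 𝔫) := by
    intro 𝔫 h𝔫
    haveI := h𝔫
    -- `𝔫 = 𝔪/I` for `𝔪 = 𝔫.comap mk ⊇ I`
    haveI : (𝔫.comap (Ideal.Quotient.mk I)).IsMaximal := Ideal.comap_isMaximal_of_surjective _
      Ideal.Quotient.mk_surjective
    have h𝔫 : (𝔫.comap (Ideal.Quotient.mk I)).map (Ideal.Quotient.mk I) = 𝔫 :=
      Ideal.map_comap_of_surjective _ Ideal.Quotient.mk_surjective 𝔫
    have := surjective_linCombQuotSq_quotient u I (𝔫.comap (Ideal.Quotient.mk I))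
      (hu _ inferInstance)
    rwa [h𝔫] at this
  refine (isGeneric_isRegularLocalRing_quotient_linComb_of_isRegularLocalRing
    (Ideal.Quotient.mk I ∘ u) huB).mono fun t ht 𝔪 _ hI hreg hmem => ?_
  haveI : (𝔪.map (Ideal.Quotient.mk I)).IsMaximal := map_mk_isMaximal I 𝔪 hI
  have hsB : linComb (Ideal.Quotient.mk I ∘ u) t = Ideal.Quotient.mk I (linComb u t) := by
    simp only [linComb, map_sum, Function.comp_apply]
    refine Finset.sum_congr rfl fun j _ => ?_
    rw [Algebra.smul_def, Algebra.smul_def, map_mul]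
    rfl
  have hregB : IsRegularLocalRing (Localization.AtPrime (𝔪.map (Ideal.Quotient.mk I))) :=
    IsRegularLocalRing.of_ringEquiv (quotLocEquiv I 𝔪 (𝔪.map (Ideal.Quotient.mk I)) rfl).toRingEquiv.symm
  have hmemB : linComb (Ideal.Quotient.mk I ∘ u) t ∈ 𝔪.map (Ideal.Quotient.mk I) := by
    rw [hsB]; exact Ideal.mem_map_of_mem _ hmem
  have H := ht (𝔪.map (Ideal.Quotient.mk I)) hregB hmemB
  rw [hsB] at H
  exact isRegularLocalRing_quotient_map_sup I 𝔪 (𝔪.map (Ideal.Quotient.mk I)) rfl (linComb u t) H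

end BertiniAffine

end Literature.AlgebraicGeometry.Resolution

end
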